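import Summits.ResolutionOfSingularities.ResolutionOfSingularities.Theorems.FrobeniusLadderFInjectiveMacaulayficationSigma7Lx6c5NewtonKFan
import Summits.ResolutionOfSingularities.ResolutionOfSingularities.Theorems.FrobeniusLadderFInjectiveMacaulayficationSigma7Lx6c5PointFloor
import Summits.ResolutionOfSingularities.ResolutionOfSingularities.Theorems.FrobeniusLadderFInjectiveMacaulayficationFHalfRowOfWeaklyNondegenerate
import Summits.ResolutionOfSingularities.ResolutionOfSingularities.Theorems.FrobeniusLadderFInjectiveMacaulayficationFHalfRowOfToricCoverData
import Summits.ResolutionOfSingularities.ResolutionOfSingularities.Theorems.FrobeniusLadderFInjectiveMacaulayficationPolyAutRowTransport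
import Summits.ResolutionOfSingularities.ResolutionOfSingularities.Theorems.FrobeniusLadderFInjectiveMacaulayficationGermOfGlobalBlowup
import HarnessLib

/-!
# ★★★ COVERAGE BED d4lx6c5 `z² + x⁶z + y³ + u³ + t⁵` (char 2) RE-PROVED BY THE CLASS THEOREM: `f′ = σ₇(f) = z² + x⁶z + x¹³ + x¹⁴ + y³ + u³ + t⁵` — the point floor of `V(f′)` is cured by the monomial
# blowing up `𝔪·K` read off the `Σ_f′ ∧ Σ(𝔪)` fan (387 charts), with NO Fedder cell and NO strict-transform table — and, along `σ₇ : z ↦ z + x⁷` (res-L1-w45a-stub-1ʼs transport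
# ✓ `PolyAutRowTransport`), THE POINT-FLOOR ROW AND THE GERM ROW OF THE CENSUS BED d4lx6c5 THROUGH (B″) + TRANSPORT
# (crux `FInjectiveMacaulayfication` stmt-ResolutionOfSingularities-15315, chain w45a; res-L1-w45a-plan-1 RULING R22.20 (3) «TASK 3 = the two BED-D-sized COVERAGE BEDS lx6q7∘σ₇ and
# lx6c5∘σ₇»; seat res-L1-w45a-stub-3 g12; template = res-L1-w45a-stub-2 g11ʼs pilot ✓ `Sigma5P2d4CPointFloorRowClass` (itself on this seatʼs BED W `…P3d4z4557PointFloorRowClass`))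

[OURS · L1 W4.5a] Support file (`--supports stmt-ResolutionOfSingularities-15315 --as helper`); def-free, unconditional; replaces the role of NO printed item;
NOT a statement of the manuscript; AI-written (AI review is weaker than expert review). One more cross-certificate of a census row (coverage of the class route), OURS counted 0;
nothing of the crux is proved.

`X′ = Spec (k[X₀..X₄]/(f′))`, `f′ = X 4 ^ 2 + X 0 ^ 6 * X 4 + X 0 ^ 13 + X 0 ^ 14 + X 1 ^ 3 + X 2 ^ 3 + X 3 ^ 5`, `k = k̄` of characteristic 2, `v` = the vertex, floor centre
`𝔪 = (x̄, ȳ, ū, t̄, z̄)`, `A = 𝔪·K` = `genSet 5 Sigma7Lx6c5NewtonKFan.AL2` (fan `fan_lx6c5s7.json`, kit job cover data `Sigma7Lx6c5NewtonK*`). THEN: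
* §0 `exists_refining_strictTransform` — `θ_{V c} f′ = Y^{V c·u₀ c} · g_c`, `g_c(0) ≠ 0` on each chart (Newton chart lemma on the tabulated common minimiser);
* §1 `affineBlowup_mK_fullCl_class` — `Bl_{𝔪·K} X′` is FULL at EVERY point (one term on ✓ p656605 §2);
* §2 ★★ `pointFloor_sigma7_row_class` — for EVERY blowing up `g : S′ → Spec 𝒪_{X′,v}` along `𝔪·𝒪_{X′,v}` there is `𝓚 ≠ ⊥` on `S′`, supported over the closed point, ALL of whose
  blowings up are FULL at every stalk (one term on ✓ p656605 §3 `fHalfRow_of_weaklyNondegenerate`);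
* §3 ★★ `f4pos_row_sigma7_class` — conjoined with the input side `Sigma7Lx6c5PointFloor` (LEGAL, NOT FULL): the two-sided row for `V(f′)` at the point floor;
* §4 ★ `sigma7_fInjectivizationGermAt` — the germ shape `GermForm.FInjectivizationGermAt 2 v` for `V(f′)` (✓ `GermOfGlobalBlowup.fInjectivizationGermAt_of_affineBlowup` on §1);
* §T `aeval_sigma7_f`, `exists_sigma7`, `pointFloorRow_of_sigma7`, `fInjectivizationGermAt_of_sigma7` — the transport along `σ₇` (✓ `PolyAutRowTransport.exists_translate`,
  `pointFloorRow_of_algEquiv`, `fInjectivizationGermAt_of_algEquiv`);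
* §5 ★★★ `pointFloorRow_lx6c5_class` / `lx6c5_fInjectivizationGermAt_class` — THE SAME TWO STATEMENTS FOR THE CENSUS BED d4lx6c5 `f = X 4 ^ 2 + X 0 ^ 6 * X 4 + X 1 ^ 3 + X 2 ^ 3 + X 3 ^ 5`
  (`k = k̄`, char 2): a SECOND, independent kernel proof of the statement of ✓ p650217 `Lx6c5PointFloorRow.f4pos_row_five` (there: a fan found by search + thin Fedder cells).
  The only extra hypothesis w.r.t. the cell row is `k = k̄` (the class theoremʼs standing assumption).
Inputs: `Sigma7Lx6c5Specimen.prime_f` / `regular_off_vertex` / `mk_X_ne_zero` / `weaklyNondegenerate`, the binders of `Sigma7Lx6c5NewtonKFan` (fan side read off kernel checks;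
Newton side `hmin`), `Sigma7Lx6c5PointFloor` (input side), ✓ `PolyAutRowTransport` (transport).
[OURS · certificate instance + assembly of landed theorems] [cite: IshiiSingularities2018, Thm. 4.4.23, Lemma 4.4.24, Cor. 4.4.25 (pp. 95–97)] [cite: StacksProject, Tag 080A]
[cite: GortzWedhorn2020, Prop. 13.91 (2), (13.19)] [cite: Hartshorne1977, I §1]
-/

-- single-problem summit: the doubled namespace component is forced
set_option linter.dupNamespace false

noncomputable section

open AlgebraicGeometry CategoryTheory Literature.AlgebraicGeometry.Resolution TopologicalSpace IsLocalRing MvPolynomial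

namespace Summit.ResolutionOfSingularities.ResolutionOfSingularities.Theorems.FInjectiveMacaulayfication.Sigma7Lx6c5PointFloorRowClass

open Summit.ResolutionOfSingularities.ResolutionOfSingularities.Theorems.FInjectiveMacaulayfication
open SliceableCentre GermForm FanCheckKit PolyAutRowTransport Sigma7Lx6c5NewtonKFan

/-! ## §0 The refining strict transforms from the Newton minimisers -/

/-- On every chart of the `Σ_f′ ∧ Σ(𝔪)` fan, `θ_{V c} f′ = Y^{V c · u₀ c} · g_c` with `g_c(0) ≠ 0` — the Newton chart lemma on the tabulated common minimiser.
[cite: IshiiSingularities2018, proof of Lemma 4.4.24 (p. 96)] -/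
theorem exists_refining_strictTransform (k : Type) [Field k] (f : MvPolynomial (Fin 5) k)
    (hf : f = X 4 ^ 2 + X 0 ^ 6 * X 4 + X 0 ^ 13 + X 0 ^ 14 + X 1 ^ 3 + X 2 ^ 3 + X 3 ^ 5) (c : Fin 387) :
    ∃ g : MvPolynomial (Fin 5) k, aeval (fun j : Fin 5 => ∏ i : Fin 5, (X i : MvPolynomial (Fin 5) k) ^ Vq c i j) f =
      monomial (Finsupp.equivFunOnFinite.symm ((Vq c).mulVec ⇑(Finsupp.equivFunOnFinite.symm (U0 c) : Fin 5 →₀ ℕ))) 1 * g ∧ constantCoeff g ≠ 0 :=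
  NewtonChartLemma.exists_theta_eq_monomial_mul_of_commonMinimiser (Vq c) (hV c) f _ (hu₀ k f hf c) (hmin k f hf c)

/-! ## §1 `Bl_{𝔪·K} X′` is FULL everywhere -/

/-- ★ **`Bl_{𝔪·K} X′` IS FULL AT EVERY POINT** (class route: weak non-degeneracy + Newton fan cover data; no Fedder cell). [OURS · certificate instance]
[cite: IshiiSingularities2018, Thm. 4.4.23 and Cor. 4.4.25] -/
theorem affineBlowup_mK_fullCl_class (k : Type) [Field k] [IsAlgClosed k] [CharP k 2] (f : MvPolynomial (Fin 5) k)
    (hf : f = X 4 ^ 2 + X 0 ^ 6 * X 4 + X 0 ^ 13 + X 0 ^ 14 + X 1 ^ 3 + X 2 ^ 3 + X 3 ^ 5) :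
    ∀ y : ↥(affineBlowup (Ideal.span ((fun e : Fin 5 →₀ ℕ => Ideal.Quotient.mk (Ideal.span {f}) (monomial e (1 : k))) '' (genSet 5 AL2 : Set (Fin 5 →₀ ℕ))))),
      FullCl 2 ((affineBlowup (Ideal.span ((fun e : Fin 5 →₀ ℕ => Ideal.Quotient.mk (Ideal.span {f}) (monomial e (1 : k))) '' (genSet 5 AL2 : Set (Fin 5 →₀ ℕ))))).presheaf.stalk y) := by
  classical
  haveI : Fact (Nat.Prime 2) := ⟨Nat.prime_two⟩
  choose g hθ hg0 using exists_refining_strictTransform k f hf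
  exact FHalfRowOfNewtonNondegenerate.affineBlowup_fullCl_of_weaklyNondegenerate 2 k f (Sigma7Lx6c5Specimen.prime_f k f hf)
    (Sigma7Lx6c5Specimen.weaklyNondegenerate k f hf) (Sigma7Lx6c5Specimen.mk_X_ne_zero k f hf)
    (fun x hx => Sigma7Lx6c5Specimen.regular_off_vertex k f hf x.asIdeal hx)
    (genSet 5 AL2) hprimAJ.2.1 hprimAJ.1 387 (chartM 5 AL2 CL 387) (hcov k) Vq hV (chartA 5 AL2 CL 387) haA hgen hge g _ hθ hg0 (Sigma7Lx6c5NewtonKFan.hv k _)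

/-! ## §2 ★★ The cure of the point floor, by the class theorem -/

/-- ★★ **THE POINT FLOOR OF `V(f′)` IS CURED — BY THE CLASS THEOREM** (`k = k̄`, char 2). See the module docstring. [OURS · certificate instance]
[cite: IshiiSingularities2018, Thm. 4.4.23 and Cor. 4.4.25] [cite: StacksProject, Tag 080A] -/
theorem pointFloor_sigma7_row_class (k : Type) [Field k] [IsAlgClosed k] [CharP k 2] (f : MvPolynomial (Fin 5) k)
    (hf : f = X 4 ^ 2 + X 0 ^ 6 * X 4 + X 0 ^ 13 + X 0 ^ 14 + X 1 ^ 3 + X 2 ^ 3 + X 3 ^ 5)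
    (v : Spec (.of (MvPolynomial (Fin 5) k ⧸ Ideal.span {f})))
    (hv : v.asIdeal = Ideal.span (Set.range (fun j : Fin 5 => Ideal.Quotient.mk (Ideal.span {f}) (X j)))) :
    ∀ (S' : Scheme.{0}) (g : S' ⟶ Spec ((Spec (.of (MvPolynomial (Fin 5) k ⧸ Ideal.span {f}))).presheaf.stalk v)),
      IsBlowup g ((affineBlowup.idealSheaf (Ideal.span (Set.range (fun j : Fin 5 => Ideal.Quotient.mk (Ideal.span {f}) (X j))))).comap
        ((Spec (.of (MvPolynomial (Fin 5) k ⧸ Ideal.span {f}))).fromSpecStalk v)) →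
      ∃ 𝓚 : S'.IdealSheafData, 𝓚 ≠ ⊥ ∧
        (∀ s ∈ (𝓚.support : Set S'), g.base s = closedPoint ((Spec (.of (MvPolynomial (Fin 5) k ⧸ Ideal.span {f}))).presheaf.stalk v)) ∧
        ∀ (S'' : Scheme.{0}) (π : S'' ⟶ S'), IsBlowup π 𝓚 → ∀ s : S'', FullCl 2 (S''.presheaf.stalk s) := by
  classical
  haveI : Fact (Nat.Prime 2) := ⟨Nat.prime_two⟩
  choose g hθ hg0 using exists_refining_strictTransform k f hf
  exact FHalfRowOfNewtonNondegenerate.fHalfRow_of_weaklyNondegenerate 2 k (by norm_num) f (Sigma7Lx6c5Specimen.prime_f k f hf)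
    (Sigma7Lx6c5Specimen.weaklyNondegenerate k f hf) (Sigma7Lx6c5Specimen.mk_X_ne_zero k f hf)
    (fun x hx => Sigma7Lx6c5Specimen.regular_off_vertex k f hf x.asIdeal hx)
    (genSet 5 AL2) (genSet 5 KL2) (span_A_eq_floor_mul_K k _).1 hKprim.1 hprimAJ.2.1 hprimAJ.1 387 (chartM 5 AL2 CL 387) (hcov k) Vq hV
    (chartA 5 AL2 CL 387) haA hgen hge g _ hθ hg0 (Sigma7Lx6c5NewtonKFan.hv k _) v hv

/-! ## §3 ★★ The two-sided row for `V(f′)`, by the class route -/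

/-- ★★ **THE TWO-SIDED ROW FOR `V(f′)` AT THE POINT FLOOR: LEGAL ∧ NOT F(4)-iso (p = 2) ∧ CURED** (`k = k̄`). The first two conjuncts are this seatʼs `Sigma7Lx6c5PointFloor`
(input side), the third is §2. [OURS · assembly of landed theorems] -/
theorem f4pos_row_sigma7_class (k : Type) [Field k] [IsAlgClosed k] [CharP k 2] (f : MvPolynomial (Fin 5) k)
    (hf : f = X 4 ^ 2 + X 0 ^ 6 * X 4 + X 0 ^ 13 + X 0 ^ 14 + X 1 ^ 3 + X 2 ^ 3 + X 3 ^ 5)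
    (v : Spec (.of (MvPolynomial (Fin 5) k ⧸ Ideal.span {f})))
    (hv : v.asIdeal = Ideal.span (Set.range (fun j : Fin 5 => Ideal.Quotient.mk (Ideal.span {f}) (X j))))
    (S' : Scheme.{0}) (g : S' ⟶ Spec ((Spec (.of (MvPolynomial (Fin 5) k ⧸ Ideal.span {f}))).presheaf.stalk v))
    (hg : IsBlowup g ((affineBlowup.idealSheaf (Ideal.span (Set.range (fun j : Fin 5 => Ideal.Quotient.mk (Ideal.span {f}) (X j))))).comap
      ((Spec (.of (MvPolynomial (Fin 5) k ⧸ Ideal.span {f}))).fromSpecStalk v))) :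
    (((affineBlowup.idealSheaf (Ideal.span (Set.range (fun j : Fin 5 => Ideal.Quotient.mk (Ideal.span {f}) (X j))))).comap
        ((Spec (.of (MvPolynomial (Fin 5) k ⧸ Ideal.span {f}))).fromSpecStalk v)) ≠ ⊥ ∧
      (((((affineBlowup.idealSheaf (Ideal.span (Set.range (fun j : Fin 5 => Ideal.Quotient.mk (Ideal.span {f}) (X j))))).comap
        ((Spec (.of (MvPolynomial (Fin 5) k ⧸ Ideal.span {f}))).fromSpecStalk v))).support :
          Set (Spec ((Spec (.of (MvPolynomial (Fin 5) k ⧸ Ideal.span {f}))).presheaf.stalk v))) ⊆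
        (Scheme.regularLocus (Spec ((Spec (.of (MvPolynomial (Fin 5) k ⧸ Ideal.span {f}))).presheaf.stalk v)))ᶜ) ∧
      (∀ s : S', g.base s ≠ closedPoint ((Spec (.of (MvPolynomial (Fin 5) k ⧸ Ideal.span {f}))).presheaf.stalk v) → s ∈ Scheme.regularLocus S') ∧
      (∀ s : S', CMCl (S'.presheaf.stalk s))) ∧
    (∃ s : S', g.base s = closedPoint ((Spec (.of (MvPolynomial (Fin 5) k ⧸ Ideal.span {f}))).presheaf.stalk v) ∧ ¬ FullCl 2 (S'.presheaf.stalk s)) ∧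
    (∃ 𝓚 : S'.IdealSheafData, 𝓚 ≠ ⊥ ∧
      (∀ s ∈ (𝓚.support : Set S'), g.base s = closedPoint ((Spec (.of (MvPolynomial (Fin 5) k ⧸ Ideal.span {f}))).presheaf.stalk v)) ∧
      ∀ (S'' : Scheme.{0}) (π : S'' ⟶ S'), IsBlowup π 𝓚 → ∀ s : S'', FullCl 2 (S''.presheaf.stalk s)) :=
  ⟨Sigma7Lx6c5PointFloor.pointFloor_sigma7_input_legal k f hf v hv S' g hg, Sigma7Lx6c5PointFloor.pointFloor_sigma7_not_full k f hf v hv S' g hg,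
    pointFloor_sigma7_row_class k f hf v hv S' g hg⟩

/-! ## §4 ★ The germ shape for `V(f′)` -/

/-- ★ **`FInjectivizationGermAt 2 v` AT THE VERTEX OF `V(f′)`** (`k = k̄`, char 2): one `𝔪`-primary monomial blowing up of `Spec 𝒪_{X′,v}` (along `𝔪·K`) is FULL at every stalk
(§1 + ✓ `GermOfGlobalBlowup.fInjectivizationGermAt_of_affineBlowup`). [OURS · certificate instance; cite: GortzWedhorn2020, Prop. 13.91 (2)] -/
theorem sigma7_fInjectivizationGermAt (k : Type) [Field k] [IsAlgClosed k] [CharP k 2] (f : MvPolynomial (Fin 5) k)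
    (hf : f = X 4 ^ 2 + X 0 ^ 6 * X 4 + X 0 ^ 13 + X 0 ^ 14 + X 1 ^ 3 + X 2 ^ 3 + X 3 ^ 5)
    (v : Spec (.of (MvPolynomial (Fin 5) k ⧸ Ideal.span {f})))
    (hv : v.asIdeal = Ideal.span (Set.range (fun j : Fin 5 => Ideal.Quotient.mk (Ideal.span {f}) (X j)))) :
    FInjectivizationGermAt 2 v := by
  classical
  haveI hp : (Ideal.span {f}).IsPrime := Sigma7Lx6c5Specimen.isPrime_span_f k f hf
  haveI : IsDomain (MvPolynomial (Fin 5) k ⧸ Ideal.span {f}) := Ideal.Quotient.isDomain _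
  have hpow : ∀ j : Fin 5, ∃ N : ℕ, (Ideal.Quotient.mk (Ideal.span {f}) (X j)) ^ N ∈
      Ideal.span ((fun e : Fin 5 →₀ ℕ => Ideal.Quotient.mk (Ideal.span {f}) (monomial e (1 : k))) '' (genSet 5 AL2 : Set (Fin 5 →₀ ℕ))) := by
    intro j
    obtain ⟨N, hN⟩ := hprimAJ.2.1 j (Finset.mem_univ j)
    refine ⟨N, ?_⟩
    have e : (Ideal.Quotient.mk (Ideal.span {f}) (X j)) ^ N = Ideal.Quotient.mk (Ideal.span {f}) (monomial (Finsupp.single j N) (1 : k)) := by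
      rw [← map_pow, X_pow_eq_monomial]
    rw [e]
    exact Ideal.subset_span ⟨_, Finset.mem_coe.mpr hN, rfl⟩
  refine GermOfGlobalBlowup.fInjectivizationGermAt_of_affineBlowup 2 _ ?_ v ?_ (affineBlowup_mK_fullCl_class k f hf)
  · obtain ⟨N, hN⟩ := hpow 0
    intro hbot
    rw [hbot, Ideal.mem_bot] at hN
    exact pow_ne_zero N (Sigma7Lx6c5Specimen.mk_X_ne_zero k f hf 0) hN
  · rw [hv, Ideal.span_le]
    rintro _ ⟨j, rfl⟩
    obtain ⟨N, hN⟩ := hpow j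
    exact ⟨N, hN⟩

/-! ## §T `σ₇ f = f′` in characteristic 2 and the transport (res-L1-w45a-stub-1ʼs ✓ `PolyAutRowTransport`, as in ✓ p680195 `P2d4CSigma5Transport`) -/

/-- **`σ₇ f = f′`** (`σ₇ : z ↦ z + x⁷`, characteristic 2): `(z + x⁷)² + x⁶(z + x⁷) + … = z² + x⁶z + x¹³ + x¹⁴ + y³ + u³ + t⁵` since `2x⁷z = 0`. [folklore] -/
theorem aeval_sigma7_f (k : Type) [Field k] [CharP k 2] (f f' : MvPolynomial (Fin 5) k) (hf : f = X 4 ^ 2 + X 0 ^ 6 * X 4 + X 1 ^ 3 + X 2 ^ 3 + X 3 ^ 5)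
    (hf' : f' = X 4 ^ 2 + X 0 ^ 6 * X 4 + X 0 ^ 13 + X 0 ^ 14 + X 1 ^ 3 + X 2 ^ 3 + X 3 ^ 5) :
    aeval (fun l : Fin 5 => if l = 4 then X 4 + C (1 : k) * X 0 ^ 7 else (X l : MvPolynomial (Fin 5) k)) f = f' := by
  have h2 : (2 : MvPolynomial (Fin 5) k) = 0 := by
    have h := CharP.cast_eq_zero (MvPolynomial (Fin 5) k) 2
    simpa using h
  have e : aeval (fun l : Fin 5 => if l = 4 then X 4 + C (1 : k) * X 0 ^ 7 else (X l : MvPolynomial (Fin 5) k)) f = f' + 2 * (X 0 ^ 7 * X 4) := by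
    subst hf hf'
    simp only [map_add, map_mul, map_pow, aeval_X, C_1, one_mul]
    simp only [Fin.isValue, Fin.reduceEq, if_false, if_true]
    ring
  rw [e, h2, zero_mul, add_zero]

/-- **`σ₇` as a ring automorphism of `k[x,y,u,t,z]`** with `σ₇(Xᵢ)`, `σ₇⁻¹(Xᵢ)` constant-term-free and `σ₇ f = f′` (characteristic 2; ✓ `PolyAutRowTransport.exists_translate`). [folklore] -/
theorem exists_sigma7 (k : Type) [Field k] [CharP k 2] (f f' : MvPolynomial (Fin 5) k) (hf : f = X 4 ^ 2 + X 0 ^ 6 * X 4 + X 1 ^ 3 + X 2 ^ 3 + X 3 ^ 5)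
    (hf' : f' = X 4 ^ 2 + X 0 ^ 6 * X 4 + X 0 ^ 13 + X 0 ^ 14 + X 1 ^ 3 + X 2 ^ 3 + X 3 ^ 5) :
    ∃ φ : MvPolynomial (Fin 5) k ≃+* MvPolynomial (Fin 5) k,
      (∀ l : Fin 5, constantCoeff (φ (X l)) = 0) ∧ (∀ l : Fin 5, constantCoeff (φ.symm (X l)) = 0) ∧ φ f = f' := by
  obtain ⟨φ, hφ, h₁, h₂⟩ := exists_translate k (0 : Fin 5) 4 (by decide) (1 : k) 7 (by norm_num)
  exact ⟨φ, h₁, h₂, by rw [hφ]; exact aeval_sigma7_f k f f' hf hf'⟩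

/-- ★ **A census row for `V(f′)` at the origin IS a census row for d4lx6c5 at the origin** (characteristic 2; `FullCl p` for any `p`), by ✓ `pointFloorRow_of_algEquiv`. [folklore; cite: GortzWedhorn2020, (13.19)] -/
theorem pointFloorRow_of_sigma7 (k : Type) [Field k] (p : ℕ) [CharP k 2] (f f' : MvPolynomial (Fin 5) k) (hf : f = X 4 ^ 2 + X 0 ^ 6 * X 4 + X 1 ^ 3 + X 2 ^ 3 + X 3 ^ 5)
    (hf' : f' = X 4 ^ 2 + X 0 ^ 6 * X 4 + X 0 ^ 13 + X 0 ^ 14 + X 1 ^ 3 + X 2 ^ 3 + X 3 ^ 5)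
    (hrow : ∀ (v : Spec (.of (MvPolynomial (Fin 5) k ⧸ Ideal.span {f'}))),
      v.asIdeal = Ideal.span (Set.range fun j : Fin 5 => Ideal.Quotient.mk (Ideal.span {f'}) (X j)) →
      ∀ (S' : Scheme.{0}) (g₁ : S' ⟶ Spec ((Spec (.of (MvPolynomial (Fin 5) k ⧸ Ideal.span {f'}))).presheaf.stalk v)),
        IsBlowup g₁ ((affineBlowup.idealSheaf (Ideal.span (Set.range fun j : Fin 5 => Ideal.Quotient.mk (Ideal.span {f'}) (X j)))).comap
          ((Spec (.of (MvPolynomial (Fin 5) k ⧸ Ideal.span {f'}))).fromSpecStalk v)) →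
        (((affineBlowup.idealSheaf (Ideal.span (Set.range fun j : Fin 5 => Ideal.Quotient.mk (Ideal.span {f'}) (X j)))).comap
            ((Spec (.of (MvPolynomial (Fin 5) k ⧸ Ideal.span {f'}))).fromSpecStalk v)) ≠ ⊥ ∧
          ((((affineBlowup.idealSheaf (Ideal.span (Set.range fun j : Fin 5 => Ideal.Quotient.mk (Ideal.span {f'}) (X j)))).comap
            ((Spec (.of (MvPolynomial (Fin 5) k ⧸ Ideal.span {f'}))).fromSpecStalk v)).support :
              Set (Spec ((Spec (.of (MvPolynomial (Fin 5) k ⧸ Ideal.span {f'}))).presheaf.stalk v))) ⊆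
            (Scheme.regularLocus (Spec ((Spec (.of (MvPolynomial (Fin 5) k ⧸ Ideal.span {f'}))).presheaf.stalk v)))ᶜ) ∧
          (∀ s : S', g₁.base s ≠ closedPoint _ → s ∈ Scheme.regularLocus S') ∧ (∀ s : S', CMCl (S'.presheaf.stalk s))) ∧
        (∃ s : S', g₁.base s = closedPoint _ ∧ ¬ FullCl p (S'.presheaf.stalk s)) ∧
        (∃ 𝓚 : S'.IdealSheafData, 𝓚 ≠ ⊥ ∧ (∀ s ∈ (𝓚.support : Set S'), g₁.base s = closedPoint _) ∧
          ∀ (S'' : Scheme.{0}) (π : S'' ⟶ S'), IsBlowup π 𝓚 → ∀ s : S'', FullCl p (S''.presheaf.stalk s))) :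
    ∀ (v' : Spec (.of (MvPolynomial (Fin 5) k ⧸ Ideal.span {f}))),
      v'.asIdeal = Ideal.span (Set.range fun j : Fin 5 => Ideal.Quotient.mk (Ideal.span {f}) (X j)) →
      ∀ (S' : Scheme.{0}) (g₁ : S' ⟶ Spec ((Spec (.of (MvPolynomial (Fin 5) k ⧸ Ideal.span {f}))).presheaf.stalk v')),
        IsBlowup g₁ ((affineBlowup.idealSheaf (Ideal.span (Set.range fun j : Fin 5 => Ideal.Quotient.mk (Ideal.span {f}) (X j)))).comap
          ((Spec (.of (MvPolynomial (Fin 5) k ⧸ Ideal.span {f}))).fromSpecStalk v')) →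
        (((affineBlowup.idealSheaf (Ideal.span (Set.range fun j : Fin 5 => Ideal.Quotient.mk (Ideal.span {f}) (X j)))).comap
            ((Spec (.of (MvPolynomial (Fin 5) k ⧸ Ideal.span {f}))).fromSpecStalk v')) ≠ ⊥ ∧
          ((((affineBlowup.idealSheaf (Ideal.span (Set.range fun j : Fin 5 => Ideal.Quotient.mk (Ideal.span {f}) (X j)))).comap
            ((Spec (.of (MvPolynomial (Fin 5) k ⧸ Ideal.span {f}))).fromSpecStalk v')).support :
              Set (Spec ((Spec (.of (MvPolynomial (Fin 5) k ⧸ Ideal.span {f}))).presheaf.stalk v'))) ⊆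
            (Scheme.regularLocus (Spec ((Spec (.of (MvPolynomial (Fin 5) k ⧸ Ideal.span {f}))).presheaf.stalk v')))ᶜ) ∧
          (∀ s : S', g₁.base s ≠ closedPoint _ → s ∈ Scheme.regularLocus S') ∧ (∀ s : S', CMCl (S'.presheaf.stalk s))) ∧
        (∃ s : S', g₁.base s = closedPoint _ ∧ ¬ FullCl p (S'.presheaf.stalk s)) ∧
        (∃ 𝓚 : S'.IdealSheafData, 𝓚 ≠ ⊥ ∧ (∀ s ∈ (𝓚.support : Set S'), g₁.base s = closedPoint _) ∧
          ∀ (S'' : Scheme.{0}) (π : S'' ⟶ S'), IsBlowup π 𝓚 → ∀ s : S'', FullCl p (S''.presheaf.stalk s)) := by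
  obtain ⟨φ, h₁, h₂, hφf⟩ := exists_sigma7 k f f' hf hf'
  exact pointFloorRow_of_algEquiv k p φ h₁ h₂ f f' hφf hrow

/-- ★ **The germ shape**: `FInjectivizationGermAt p` at the origin of `V(f′)` implies it at the origin of d4lx6c5 (characteristic 2), by ✓ `fInjectivizationGermAt_of_algEquiv`. [folklore] -/
theorem fInjectivizationGermAt_of_sigma7 (k : Type) [Field k] (p : ℕ) [CharP k 2] (f f' : MvPolynomial (Fin 5) k) (hf : f = X 4 ^ 2 + X 0 ^ 6 * X 4 + X 1 ^ 3 + X 2 ^ 3 + X 3 ^ 5)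
    (hf' : f' = X 4 ^ 2 + X 0 ^ 6 * X 4 + X 0 ^ 13 + X 0 ^ 14 + X 1 ^ 3 + X 2 ^ 3 + X 3 ^ 5)
    (hgerm : ∀ v : Spec (.of (MvPolynomial (Fin 5) k ⧸ Ideal.span {f'})),
      v.asIdeal = Ideal.span (Set.range fun j : Fin 5 => Ideal.Quotient.mk (Ideal.span {f'}) (X j)) → FInjectivizationGermAt p v) :
    ∀ v' : Spec (.of (MvPolynomial (Fin 5) k ⧸ Ideal.span {f})),
      v'.asIdeal = Ideal.span (Set.range fun j : Fin 5 => Ideal.Quotient.mk (Ideal.span {f}) (X j)) → FInjectivizationGermAt p v' := by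
  obtain ⟨φ, h₁, h₂, hφf⟩ := exists_sigma7 k f f' hf hf'
  exact fInjectivizationGermAt_of_algEquiv k p φ h₁ h₂ f f' hφf hgerm

/-! ## §5 ★★★ TRANSPORT TO THE CENSUS BED d4lx6c5 -/

/-- ★★★ **THE POINT-FLOOR ROW OF d4lx6c5 `z² + x⁶z + y³ + u³ + t⁵` (char 2, `k = k̄`) — LEGAL ∧ NOT F(4)-iso ∧ CURED — RE-PROVED THROUGH THE CLASS ROUTE** (a second, independent kernel
proof of ✓ p650217 `Lx6c5PointFloorRow.f4pos_row_five`ʼs statement over `k = k̄`): §3 for `f′ = σ₇ f` transported along `σ₇ : z ↦ z + x⁷` (§T). [OURS · assembly of landed theorems; cite: GortzWedhorn2020, (13.19)] -/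
theorem pointFloorRow_lx6c5_class (k : Type) [Field k] [IsAlgClosed k] [CharP k 2] (f : MvPolynomial (Fin 5) k)
    (hf : f = X 4 ^ 2 + X 0 ^ 6 * X 4 + X 1 ^ 3 + X 2 ^ 3 + X 3 ^ 5) :
    ∀ (v' : Spec (.of (MvPolynomial (Fin 5) k ⧸ Ideal.span {f}))),
      v'.asIdeal = Ideal.span (Set.range fun j : Fin 5 => Ideal.Quotient.mk (Ideal.span {f}) (X j)) →
      ∀ (S' : Scheme.{0}) (g₁ : S' ⟶ Spec ((Spec (.of (MvPolynomial (Fin 5) k ⧸ Ideal.span {f}))).presheaf.stalk v')),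
        IsBlowup g₁ ((affineBlowup.idealSheaf (Ideal.span (Set.range fun j : Fin 5 => Ideal.Quotient.mk (Ideal.span {f}) (X j)))).comap
          ((Spec (.of (MvPolynomial (Fin 5) k ⧸ Ideal.span {f}))).fromSpecStalk v')) →
        (((affineBlowup.idealSheaf (Ideal.span (Set.range fun j : Fin 5 => Ideal.Quotient.mk (Ideal.span {f}) (X j)))).comap
            ((Spec (.of (MvPolynomial (Fin 5) k ⧸ Ideal.span {f}))).fromSpecStalk v')) ≠ ⊥ ∧
          ((((affineBlowup.idealSheaf (Ideal.span (Set.range fun j : Fin 5 => Ideal.Quotient.mk (Ideal.span {f}) (X j)))).comap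
            ((Spec (.of (MvPolynomial (Fin 5) k ⧸ Ideal.span {f}))).fromSpecStalk v')).support :
              Set (Spec ((Spec (.of (MvPolynomial (Fin 5) k ⧸ Ideal.span {f}))).presheaf.stalk v'))) ⊆
            (Scheme.regularLocus (Spec ((Spec (.of (MvPolynomial (Fin 5) k ⧸ Ideal.span {f}))).presheaf.stalk v')))ᶜ) ∧
          (∀ s : S', g₁.base s ≠ closedPoint _ → s ∈ Scheme.regularLocus S') ∧ (∀ s : S', CMCl (S'.presheaf.stalk s))) ∧
        (∃ s : S', g₁.base s = closedPoint _ ∧ ¬ FullCl 2 (S'.presheaf.stalk s)) ∧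
        (∃ 𝓚 : S'.IdealSheafData, 𝓚 ≠ ⊥ ∧ (∀ s ∈ (𝓚.support : Set S'), g₁.base s = closedPoint _) ∧
          ∀ (S'' : Scheme.{0}) (π : S'' ⟶ S'), IsBlowup π 𝓚 → ∀ s : S'', FullCl 2 (S''.presheaf.stalk s)) :=
  pointFloorRow_of_sigma7 k 2 f _ hf rfl (fun v hv S' g₁ hg₁ => f4pos_row_sigma7_class k _ rfl v hv S' g₁ hg₁)

/-- ★★★ **`FInjectivizationGermAt 2 v` AT THE VERTEX OF d4lx6c5, BY THE CLASS ROUTE** (`k = k̄`, char 2): §4 for `f′` transported along `σ₇` (§T).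
[OURS · assembly of landed theorems; cite: GortzWedhorn2020, (13.19)] -/
theorem lx6c5_fInjectivizationGermAt_class (k : Type) [Field k] [IsAlgClosed k] [CharP k 2] (f : MvPolynomial (Fin 5) k)
    (hf : f = X 4 ^ 2 + X 0 ^ 6 * X 4 + X 1 ^ 3 + X 2 ^ 3 + X 3 ^ 5) :
    ∀ v' : Spec (.of (MvPolynomial (Fin 5) k ⧸ Ideal.span {f})),
      v'.asIdeal = Ideal.span (Set.range fun j : Fin 5 => Ideal.Quotient.mk (Ideal.span {f}) (X j)) → FInjectivizationGermAt 2 v' :=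
  fInjectivizationGermAt_of_sigma7 k 2 f _ hf rfl (fun v hv => sigma7_fInjectivizationGermAt k _ rfl v hv)

end Summit.ResolutionOfSingularities.ResolutionOfSingularities.Theorems.FInjectiveMacaulayfication.Sigma7Lx6c5PointFloorRowClass

end
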